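import Summits.BirchSwinnertonDyer.BirchSwinnertonDyer.Theses.LeadingTerm
import Summits.BirchSwinnertonDyer.BirchSwinnertonDyer.Theorems.LeadingTermPinchPrimeCofiniteIMC
import Summits.BirchSwinnertonDyer.BirchSwinnertonDyer.Theorems.LeadingTermPinchPrimeLeverTrivial
import Summits.BirchSwinnertonDyer.BirchSwinnertonDyer.Theorems.LeadingTermPinchPrimeLeverOrder
import Summits.BirchSwinnertonDyer.BirchSwinnertonDyer.Theorems.LeadingTermPinchPrimeCofiniteTorsion
import Summits.BirchSwinnertonDyer.BirchSwinnertonDyer.Theorems.LeadingTermPinchPrimeSemisimpleOrder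
import Summits.BirchSwinnertonDyer.BirchSwinnertonDyer.Theorems.LeadingTermPinchPrimeSemisimpleOfSchneiderAt
import Summits.BirchSwinnertonDyer.BirchSwinnertonDyer.Theorems.LeadingTermPinchPrimeOrderEqRankOfSchneiderShaAt
import Summits.BirchSwinnertonDyer.BirchSwinnertonDyer.Theorems.LeadingTermPinchPrimeSemisimpleInfinitelyOftenOfSchneider
import Summits.BirchSwinnertonDyer.BirchSwinnertonDyer.Theorems.LeadingTermPinchPrimeSemisimpleIffSchneiderInfinitelyOften
import Summits.BirchSwinnertonDyer.BirchSwinnertonDyer.Theorems.LeadingTermPinchPrimePinchAtOfOpenStubs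
import Summits.BirchSwinnertonDyer.BirchSwinnertonDyer.Theorems.LeadingTermPinchPrimeOpenStubsOfLOneNeZero
import Summits.BirchSwinnertonDyer.BirchSwinnertonDyer.Theorems.LeadingTermPinchPrimePinchAtOfAnalyticRankLeOne
import Summits.BirchSwinnertonDyer.BirchSwinnertonDyer.Theorems.LeadingTermPinchPrimeSchneiderOfHasCMRankLeOne
import Summits.BirchSwinnertonDyer.BirchSwinnertonDyer.Theorems.LeadingTermPinchPrimePinchPrimeOfOpenRanges
import Literature.NumberTheory.EllipticCurves.IwasawaSelmerDualProofs
import Literature.NumberTheory.EllipticCurves.SelmerInftyTorsionFiniteProofs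
import Literature.NumberTheory.EllipticCurves.SelmerCorankControl
import Literature.NumberTheory.EllipticCurves.SelmerCorankControlProofs
import Literature.NumberTheory.EllipticCurves.SelmerCorankHolds
import Literature.NumberTheory.EllipticCurves.ZpCorankQuasiIso
import Literature.NumberTheory.EllipticCurves.PAdicBSD
import Literature.NumberTheory.EllipticCurves.CyclotomicIwasawaMainTheoremIrreducible
import Literature.NumberTheory.EllipticCurves.ModPIrreducibleCofinite
import Literature.NumberTheory.EllipticCurves.CanonicalPAdicHeightHolds
import Literature.NumberTheory.EllipticCurves.IwasawaLeadingTerm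
import Literature.NumberTheory.EllipticCurves.IwasawaLeadingTermProofs
import Literature.NumberTheory.EllipticCurves.IwasawaOrderKernelRankProofs
import Literature.NumberTheory.EllipticCurves.KatoRankBoundProofs
import Literature.NumberTheory.EllipticCurves.BSDSha
import Literature.NumberTheory.EllipticCurves.LeadingTerm
import Literature.NumberTheory.EllipticCurves.MordellWeilTheoremProofs
import Literature.NumberTheory.EllipticCurves.MordellWeilRankZeroProofs
import Literature.NumberTheory.EllipticCurves.PAdicHeightsRegulatorProofs
import Literature.NumberTheory.EllipticCurves.BertrandCMHeightNonvanishing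
import Summits.BirchSwinnertonDyer.BirchSwinnertonDyer.Theorems.PAdicOrderV2PadicBSDrankNoExcessOfMainConjecture
import Literature.NumberTheory.EllipticCurves.SelmerCorankControlRatOrdinaryProofs
import Summits.BirchSwinnertonDyer.BirchSwinnertonDyer.Theorems.LeadingTermPinchPrimeOpenStubsOfResidual
import Summits.BirchSwinnertonDyer.BirchSwinnertonDyer.Theorems.LeadingTermPinchPrimePinchAtOfSamePrime
import Summits.BirchSwinnertonDyer.BirchSwinnertonDyer.Theorems.LeadingTermPinchPrimeSchneiderShaOfPinchAtKato
import Summits.BirchSwinnertonDyer.BirchSwinnertonDyer.Theorems.LeadingTermPinchPrimePinchPrimeOfChildren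
import Summits.BirchSwinnertonDyer.BirchSwinnertonDyer.Theses.PAdicOrderV2
import Summits.BirchSwinnertonDyer.BirchSwinnertonDyer.Theorems.PAdicOrderV2PAdicOrderThesisR2StubResidualSectorsItems
import Summits.BirchSwinnertonDyer.BirchSwinnertonDyer.Theorems.LeadingTermPinchPrimeOrderEqRankOfSchneiderShaMainConjecture
import Summits.BirchSwinnertonDyer.BirchSwinnertonDyer.Theorems.LeadingTermPinchPrimeChildrenHomes
import Summits.BirchSwinnertonDyer.BirchSwinnertonDyer.Theorems.LeadingTermPinchPrimeAnalyticRankOfRankLeOne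
import Summits.BirchSwinnertonDyer.BirchSwinnertonDyer.Theorems.PinchPrime.Negative.SummitFragmentsOfCrux

/-!
# Crux `PinchPrime` (stmt-BirchSwinnertonDyer-16218) — line `SketchIdeator2`
# (card `first-layer-stability-sharp-pinch`), LEAD SKELETON v32 (line cycle 9, lead c8)

New in v31–v32 (lead c8, line cycle 9): v31 registered a glue stub G17
`stub_min_two_analyticRank_le_rank_of_pinchPrime` (LB₂ inside the crux: `min 2 r_an ≤ rank` below
the six facts of G16) — the importable form of the crux-strategist r1's summit-strength certificate
`Cruxes/PinchPrime/SummitStrength.lean` (18:23Z, built on the landed G16). Its proof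
(`work/stubs/G17.lean`, rc 0) dry-ran `dedup.landed`: the same content had meanwhile LANDED as
`Theorems/PinchPrime/Negative/SummitFragmentsOfCrux.lean` (18:26Z: `two_le_rank_of_two_le_analyticRank`,
`min_two_analyticRank_le_rank`, `three_le_rank_of_odd`, `summitFragments_of_pinchPrime`,
`summit_iff_doublyHigher_of_pinchPrime`). v32 therefore UNREGISTERS G17 (no restatement of landed
declarations), IMPORTS that file, and keeps two PROVED remarks below (`Necessity II`):
`analyticRank_le_rank_of_analyticRank_le_two_of_PinchPrime` and the one rider not in the landed file,
`analyticRank_le_rank_of_analyticRank_le_three_of_PinchPrime` — the summit's LOWER bound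
`r_an ≤ rank` holds on `{r_an ≤ 3}` from the crux alone (LB₂ + parity window), so in
`closes hC hP hUB` the consistency crux `hC` is load-bearing for the lower bound only on `{r_an ≥ 4}`.
Registered stubs v32: A′ (item 17976), S′ (item 17975), facts (3).

New in v29–v30 (lead c8, line cycle 9; v30 = v29 with G16 LANDED p172119 as
`Theorems/LeadingTermPinchPrimeAnalyticRankOfRankLeOne.lean` and imported — registered stubs again
A′, S′, facts): ONE more glue stub, G16
`stub_analyticRank_eq_one_of_rank_eq_one_of_pinchPrime` (LANDED p172119) — NECESSITY at theorem grade, second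
instalment (the crux-strategist s2 census §0 / N6(i), `Cruxes/PinchPrime/STRATEGY-CENSUS.md`
16:24Z, "theorem-grade, not yet landed"): below SIX PUBLISHED theorems as named-fact hypotheses
(Perrin-Riou's `p`-adic Gross–Zagier `perrinRiou_padicGrossZagier`, Gross–Zagier `gross_zagier`,
Heegner points `exists_isHeegnerPoint`, modularity `exists_isNewformOf`, Hoffstein–Luo
`HoffsteinLuo1997_exists_twist_L_one_ne_zero`, Carayol `IsNewformOf.level_eq_conductorNorm`) the
crux implies the RANK-ONE CONVERSE `rank_ℤ W(ℚ) = 1 → ord_{s=1} L(W,s) = 1` for EVERY globally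
minimal elliptic `W/ℚ`, with NO Selmer-corank / `Ш` hypothesis (open in print) — chain: Carayol
⇒ conductor level; `ord_T L_p = 1` odd ⇒ `r_an` odd (Greenberg's parity window, tree theorem
`odd_analyticRank_of_order_padicLFunction_eq_one_conductorLevel_anyPrime`) ⇒ `w = -1`;
Hoffstein–Luo field `K` (odd `d_K`, Heegner, `p` split, `L(W^{d_K},1) ≠ 0`); Perrin-Riou +
Gross–Zagier (tree theorem `analyticRank_eq_one_of_order_padicLFunction_eq_one`). No Kato, no
main conjecture, no irreducibility, no Bertrand. With the refuter's rank-zero window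
(`Negative/ConsequencesOfCrux`) the PROVED remark `analyticRank_eq_rank_of_rank_le_one_of_PinchPrime`
below reads: THE CRUX CONTAINS BSD-RANK ON `{rank ≤ 1}` (and, with GZK from the facts stub, on
`{rank ≤ 1} ∪ {r_an ≤ 1}`): what is "short of the summit" in this crux is exactly the same-prime pair
on `{rank ≥ 2 ∧ r_an ≥ 2}` plus `∃p`-Schneider on non-CM analytic rank `1`. Registered stubs v29:
A′ (item 17976), S′ (item 17975), facts, G16 (4); v30 (G16 landed): A′, S′, facts (3). Inputs re-read 18:0x–18:2xZ: facts `_holds` ×5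
none; children 17975/17976 open (0 attempts); Disproof v4 unchanged (no `-- Targets`); route file
unchanged (00:27Z); TTRL 0/0/0.

New in v27–v28 (lead c6, line cycle 7; v28 = v27 with G15 LANDED p164000 as
`Theorems/LeadingTermPinchPrimeOrderEqRankOfSchneiderShaMainConjecture.lean` and imported — registered
stubs again A′, S′, facts): ONE more glue stub, G15
`stub_orderEqRank_of_schneiderSha_mainConjecture` (LANDED p164000) — pointwise SUFFICIENCY of the same-prime pair at
ANY good ordinary `p ≥ 5`, residually REDUCIBLE primes included, from the sibling route's
main-conjecture ITEM `PAdicOrderV2.PAdicOrderMainConjectureR7` (stmt-BirchSwinnertonDyer-15426) and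
PRS: it closes the irreducibility gap of cycles 5–6 at item level. With the shared Kato ITEM
`KatoDivisibility` (stmt-18082) on the necessity side (sibling route's landed
`schneiderSha_of_orderEqRank_katoDivisibility`), the PROVED remark
`PinchPrime_iff_schneiderSha_somewhere_items` below is the ITEM-LEVEL CONTENT THEOREM: modulo the
two items and two published theorems (PRS, modularity),
`LeadingTerm.PinchPrime ⟺ ∀ E/ℚ ∃ good ordinary p ≥ 5, #Ш(E/ℚ)[p^∞] < ∞ ∧ Reg_p(E) ≠ 0` — no
irreducibility, no analytic rank, no GZK, no Bertrand. Also landed this cycle (not a stub; helper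
`--supports` the child S′): `Theorems/LeadingTermPinchPrimeChildrenHomes.lean` (p163622) — the
item-level HOMES of the children: S′ ⟸ `PAdicOrder.PAdicOrderSchneiderR8` (stmt-0536); A′ ⟸
`SelmerRank.SelmerRankShaPFiniteR2` (stmt-0133); A′ ⟸ stmt-0490 ∧ `KatoCorankBound` (stmt-18048)
mod modularity; both ⟸ stmt-0490 ∧ stmt-18082 mod modularity + PRS; parent ⟸ stmt-0490 mod
modularity.

New in v25–v26 (lead c6, line cycle 7; v26 = v25 with the glue stub G14 LANDED p162919 as
`Theorems/LeadingTermPinchPrimePinchPrimeOfChildren.lean` and imported — registered stubs again A′, S′, facts). Since 09:37Z (crux-strategist s1) the two OPEN registered stubs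
ARE route items of `LeadingTerm`, verbatim: A′ = stmt-BirchSwinnertonDyer-17976
`ShaFiniteCofiniteOfTwoLeAnalyticRank` (rank 7) and S′ = stmt-BirchSwinnertonDyer-17975
`SchneiderInfinitelyOftenOfPosRank` (rank 6), both grounded OPEN-PROBLEM (g79-2/g79-3); the route
file has not re-rendered them yet (renderer error recorded by the strategist), so the stubs keep
their inline statements — the day the decls render, each stub closes by `exact <Child>_holds`.
v25 registered ONE more glue stub, G14 `stub_pinchPrime_of_children` (LANDED p162919, imported in v26): literally
`stub_theoremGradeFacts → A′ → S′ → LeadingTerm.PinchPrime` — "the child items close the parent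
modulo the facts stub" — landed as `Theorems/LeadingTermPinchPrimePinchPrimeOfChildren.lean` (p162919)
carrying the strategist's split certificate (`Cruxes/PinchPrime/SplitCertificate.lean`, which a
planner seat may not write under `Theorems/`): `leadingTermPinchPrime_of_facts_of_children` (two
landed paths G11 ∘ G5 and G10), `…_children_of_standardConjectures` (plausibility),
`…_childSha_of_shaPFinite` (dedup of A′ against the shared item `SelmerRankShaPFinite`),
`…_of_facts_of_samePrime` (the same-prime pair (J, S″) of G12). The assembly `PinchPrime_of` is now
ONE line: the landed G14 fed by the three registered stubs facts, A′, S′; the v24 composition is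
kept as the second path `PinchPrime_of_bridge`.

New in v22–v24 (lead c5, line cycle 6; v23 = v22 with the glue stub G13 LANDED p139782 as
`Theorems/LeadingTermPinchPrimeSchneiderShaOfPinchAtKato.lean` and imported — registered stubs again
A′, S′, facts; v24 adds the PROVED remark `shaFinite_somewhere_of_PinchPrime_katoBound`: the `Ш`-half
of the necessary pair is forced by the crux modulo Kato's corank bound ALONE — corank `0` by the
Kummer identity, then FINITE by `finite_primaryComponent_sha_iff_shaCorank_eq_zero`):
NECESSITY AT THEOREM GRADE. The composition (`PinchPrime_of`,
crux ⟸ A′, S′, facts through the landed G11 ∘ G5) and the three registered open/fact stubs are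
unchanged; v22 registers one more GLUE stub, G13 `stub_schneiderSha_of_pinchAt_kato` — the
POINTWISE CONVERSE of the landed G1: at a good ordinary `p ≥ 5` with a newform `f`,
`ord_{T=0} L_p(f, α_p, T) = rank` FORCES `Reg_p(E, Dh) ≠ 0` for every canonical `Dh` AND
`Ш(E/ℚ)[p^∞]` finite, modulo Perrin-Riou–Schneider and Kato's DIVISIBILITY `char X ∣ p^n L_p`
(tree named fact `kato_divisibility`, Astérisque 295 Thm 17.4 — a published theorem) instead of
the ORDER main conjecture used by `Negative/ContentOfCrux` (conjecture-strength at residually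
reducible `p`): `rank ≤ ord f_E ≤ ord g ≤ ord (ι g) = ord (p^n L_p) = ord L_p = rank`. Consequence
(`schneiderSha_somewhere_of_stubs` below, PROVED from the landed G13): modulo published theorems only, every
proof of the crux proves, for EVERY `E/ℚ`, Schneider non-degeneracy and `#Ш[p^∞] < ∞` at one and
the same good ordinary `p ≥ 5` — i.e. the same-prime residual (J, S″) of v19 MINUS
`E[p]`-irreducibility at the witness; with the landed sufficiency bridge G12 the crux is pinned
between (J, S″) and (J⁻, S″⁻) (gap: irreducibility at the witness prime, cofinite in `p`).

New in v17–v19 (lead c4, line cycle 5; v18 = v17 with the glue stub G11 LANDED p138000 and imported;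
v19 adds the PROVED same-prime residual `PinchPrime_of_samePrime` / `samePrime_of_residual` and the
counterexample shape `two_le_analyticRank_or_of_not_pinchAt`; v20 registers the same-prime bridge
as glue stub G12 `stub_pinchAt_of_samePrime`, LANDED p138339 with those theorems riding along;
v21 imports it — registered stubs again A′, S′, facts):

* CONTROL DISCHARGED. The third conjunct of the v16 facts stub, Mazur's control theorem in corank
  form `Greenberg1999_coinvariantsRank_eq_selmerCorank_rat` (Greenberg 1999 Thm 1.2), is now a
  TREE THEOREM (`Greenberg1999_coinvariantsRank_eq_selmerCorank_rat_holds`,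
  `Literature/NumberTheory/EllipticCurves/SelmerCorankControlRatOrdinaryProofs.lean`, 2026-08-17):
  it is imported and fed everywhere; no theorem of this skeleton takes it as a hypothesis any more.
* RESHAPE OF THE OPEN STUBS TO THEIR RESIDUAL RANGES, in classical language. After the known
  slices landed in cycles 3–4 (G6 `L(E,1) ≠ 0`; G7 analytic rank `≤ 1`; G8 Bertrand for CM rank
  `≤ 1`; `schneider_of_mordellWeilRank_eq_zero`), the v16 open stubs A (cofinite finiteness of
  `Ш[p^∞]`, all curves) and B (semisimplicity of `T` at `0` infinitely often, all curves) are
  THEOREMS modulo two smaller statements, which become the registered open stubs: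
  - A′ `stub_cofiniteShaFinite_of_two_le_analyticRank`: cofinite finiteness of `Ш(E/ℚ)[p^∞]` over
    the good ordinary `p`, asked ONLY for curves of analytic rank `≥ 2` (⊂ `ShaFiniteConjecture`;
    nothing is known in print for a single such curve at cofinitely many `p`);
  - S′ `stub_schneiderIO_of_pos_rank`: non-degeneracy of the canonical cyclotomic `p`-adic height
    (`Reg_p(E, Dh) ≠ 0`, Schneider's conjecture at `p`) at infinitely many good ordinary `p ≥ 5`,
    asked ONLY for curves of Mordell–Weil rank `≥ 1` that are not CM-of-rank-`1` (rank `0`: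
    `Reg_p = det ∅ = 1`; CM rank `1`: Bertrand 1984, G8) — the `∃^∞ p` weakening of
    Mazur–Stein–Tate 2006 Conj. 1.1 on exactly its open range (barrier B6: open already for
    non-CM curves of rank `1`, `∃^∞ p : h_p(P) ≠ 0`).
  The GLUE stub G11 `stub_openStubs_of_residual` (LANDED p138000,
  `Theorems/LeadingTermPinchPrimeOpenStubsOfResidual.lean`, imported in v18) derives
  the v16 pair (A for every `W`, B for every `W`) from A′, S′ and the theorem-grade facts (GZK
  for A in analytic rank `≤ 1`; rank-`0` triviality, G8 and the landed classical reading G4 for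
  B); `PinchPrime_of` is the landed bridge G5 fed by G11.
* FACTS `stub_theoremGradeFacts` (replaces `stub_namedFacts`): modularity `exists_isNewformOf`
  (BCDT 2001), the main conjecture in `Λ ⊗ ℚ_p` under irreducibility
  `burungale_castella_skinner_charIdeal_eq_padicLFunction` (BCS 2025 Thm 1.1.2(a)),
  Perrin-Riou–Schneider `Schneider1985_order_charGenerator` (BMS 2016 Thm 1.7),
  Gross–Zagier–Kolyvagin `rank_eq_analyticRank_of_analyticRank_le_one` (bsd.S17) and Bertrand
  `bertrand_pairing_self_ne_zero_of_hasCM` (LNM 1068 §3 Cor. 1) — five PUBLISHED THEOREMS, none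
  yet discharged in the tree (the price of cutting A, B down to A′, S′ is that PRS, GZK and
  Bertrand join the facts stub; control left it).
Registered stubs after v17: A′, S′, facts, G11 (4); after v18 (G11 landed): A′, S′, facts (3).

History (v1–v16, leads c0–c3; all glue LANDED and imported — see `Lines/SketchIdeator2.md`):
v2–v4 glue `stub_cofiniteIMC` p131521, `stub_leverTrivial` p131733, `stub_leverOrder` p131851,
`stub_cofiniteTorsion` p133139, `stub_semisimpleOrder` p133143; v6–v9 height-side glue G1
`stub_orderEqRankOfSchneiderShaAt` p134300 (+ `PinchPrime_of_schneiderSha_somewhere`,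
`PinchPrime_of_standardConjectures`), G2 `stub_semisimpleOfSchneiderAt` p134208, G3
`stub_semisimpleInfinitelyOftenOfSchneider` p134480, G4
`stub_semisimpleInfinitelyOften_iff_schneiderInfinitelyOften` p134659, G5 `stub_pinchAt_of_openStubs`
p134807 (the composition as an importable bridge: modularity → BCS → control → (∀ W, A) → (∀ W, B) →
crux body); known slices G6 `stub_openStubs_of_L_one_ne_zero` p135014, G7
`stub_pinchAt_of_analyticRank_le_one_of_schneiderIO` p135950 (+ `cofiniteShaFinite_of_analyticRank_le_one`),
G8 `stub_schneider_of_hasCM_of_rank_le_one` p136200 (Bertrand, Literature fact p136306); residual glue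
G9 `stub_pinchPrime_of_openRanges` p136607 and G10 `stub_pinchAt_of_openRanges_schneider` p136783
(+ `schneider_of_mordellWeilRank_eq_zero`).

Why the line has this shape (unchanged since v4/v5): modulo the theorem-grade facts the crux at a
good ordinary `p` is EXACTLY `[T semisimple at 0 on ℚ_p ⊗ X(E/ℚ_∞)] ∧ [corank Ш[p^∞] = 0]`
(`semisimple_and_shaCorank_eq_zero_of_order_eq_rank` below: the pair is NECESSARY at the pinch
prime; `stub_semisimpleOrder`: it is sufficient), so a line can only choose the quantifier split —
`Ш` COFINITE × height INFINITELY OFTEN (barrier note B1) — and then discharge the known ranges.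
-/

noncomputable section

set_option linter.dupNamespace false

namespace Summit.BirchSwinnertonDyer.BirchSwinnertonDyer.Cruxes.PinchPrime.FirstLayerStability

open scoped MatrixGroups ModularForm
open CongruenceSubgroup Literature.NumberTheory.EllipticCurves
  Literature.NumberTheory.EllipticCurves.ModularForms
open Summit.BirchSwinnertonDyer.BirchSwinnertonDyer.Theses

/-! ## The stubs (v17) -/

/-- STUB A′ (OPEN, `Ш`-side, cofinite, on its open range): for every elliptic `E/ℚ` (globally
minimal `W`) of analytic rank `≥ 2`, `Ш(E/ℚ)[p^∞]` is finite for all but finitely many good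
ordinary primes `p`. (Analytic rank `≤ 1` is Gross–Zagier–Kolyvagin:
`cofiniteShaFinite_of_analyticRank_le_one`, landed with G7.) -/
theorem stub_cofiniteShaFinite_of_two_le_analyticRank :
    ∀ (W : WeierstrassCurve ℚ) [W.IsElliptic] [W.IsGloballyMinimal], 2 ≤ W.analyticRank →
      ∃ B : Finset ℕ, ∀ p ∉ B, ∀ [Fact p.Prime], IsOrdinaryAt W p →
        Finite (AddCommGroup.primaryComponent W.sha p) := by
  sorry

/-- STUB S′ (OPEN, height side, infinitely often, on its open range — the `∃^∞ p` weakening of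
Mazur–Stein–Tate 2006 Conj. 1.1): every elliptic `E/ℚ` (globally minimal `W`) of Mordell–Weil
rank `≥ 1` which is not a CM curve of rank `1` has, outside any finite set, a good ordinary prime
`p ≥ 5` at which every canonical cyclotomic `p`-adic height datum is non-degenerate
(`Reg_p(E, Dh) ≠ 0`, Schneider's conjecture at `p`). (Rank `0`: `Reg_p = det ∅ = 1`,
`schneider_of_mordellWeilRank_eq_zero`; CM rank `1`: Bertrand 1984,
`stub_schneider_of_hasCM_of_rank_le_one`, both landed.) -/
theorem stub_schneiderIO_of_pos_rank :
    ∀ (W : WeierstrassCurve ℚ) [W.IsElliptic] [W.IsGloballyMinimal], 1 ≤ W.mordellWeilRank →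
      (W.HasCM → 2 ≤ W.mordellWeilRank) → ∀ B : Finset ℕ,
        ∃ p ∉ B, ∃ _ : Fact p.Prime, 5 ≤ p ∧ IsOrdinaryAt W p ∧
          ∀ Dh : WeierstrassCurve.PAdicHeightData W p, Dh.IsCanonical →
            WeierstrassCurve.SchneiderConjecture Dh := by
  sorry

/-- STUB (FACTS: five theorem-grade tree named facts — published theorems not yet discharged in
the tree: modularity (BCDT 2001), the cyclotomic main conjecture in `Λ ⊗ ℚ_p` under
irreducibility (BCS 2025 Thm 1.1.2(a)), Perrin-Riou–Schneider (BMS 2016 Thm 1.7),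
Gross–Zagier–Kolyvagin (Darmon 2004 Thm 3.22), Bertrand (LNM 1068 §3 Cor. 1)). Mazur's control
theorem in corank form left this stub in v17: it is the tree theorem
`Greenberg1999_coinvariantsRank_eq_selmerCorank_rat_holds`. -/
theorem stub_theoremGradeFacts :
    exists_isNewformOf ∧ burungale_castella_skinner_charIdeal_eq_padicLFunction ∧
      Schneider1985_order_charGenerator ∧ rank_eq_analyticRank_of_analyticRank_le_one ∧
      bertrand_pairing_self_ne_zero_of_hasCM := by
  sorry

-- v29 stub G16 `stub_analyticRank_eq_one_of_rank_eq_one_of_pinchPrime` (GLUE, NECESSITY at theorem grade: Perrin-Riou p-adic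
-- GZ → GZ → Heegner points → modularity → Hoffstein–Luo → Carayol → LeadingTerm.PinchPrime → ∀ W, rank = 1 → r_an = 1 —
-- the rank-one converse with NO Selmer hypothesis) LANDED p172119 as
-- `Theorems/LeadingTermPinchPrimeAnalyticRankOfRankLeOne.lean` (with the pointwise
-- `analyticRank_eq_one_of_pinchAt_of_rank_eq_one`, `analyticRank_eq_rank_of_rank_le_one_of_pinchPrime` (crux ⊇ BSD-rank
-- on {rank ≤ 1}) and `rank_eq_analyticRank_of_pinchPrime_of_le_one` (+GZK: on {rank ≤ 1} ∪ {r_an ≤ 1}) riding along);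
-- IMPORTED (v30).

-- v31 stub G17 `stub_min_two_analyticRank_le_rank_of_pinchPrime` (GLUE, NECESSITY: the six facts of G16 → LeadingTerm.PinchPrime →
-- ∀ W, min 2 r_an ≤ rank) UNREGISTERED in v32: its content landed independently as
-- `Theorems/PinchPrime/Negative/SummitFragmentsOfCrux.lean` (`min_two_analyticRank_le_rank` etc., 18:26Z), IMPORTED (v32);
-- the lead's proof `work/stubs/G17.lean` dry-ran `dedup.landed` and was not proposed.

-- v25 stub G14 `stub_pinchPrime_of_children` (GLUE: facts-conjunction → A′ → S′ → LeadingTerm.PinchPrime — the child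
-- items 17976/17975 close the parent modulo the facts stub) LANDED p162919 as
-- `Theorems/LeadingTermPinchPrimePinchPrimeOfChildren.lean` (with the crux-strategist's split certificate riding along:
-- `Theorems.leadingTermPinchPrime_of_facts_of_children`/`'`, `…_of_factsConj_of_children`,
-- `…_children_of_standardConjectures`, `…_childSha_of_shaPFinite`, `…_of_facts_of_samePrime`); IMPORTED (v26).

-- v27 stub G15 `stub_orderEqRank_of_schneiderSha_mainConjecture` (GLUE: item 15426 MainConjectureR7 → PRS → ∀ W p ≥ 5 good
-- ordinary, Ш[p^∞] finite → (∀ Dh canonical, Schneider Dh) → ∀ f newform, ord_T L_p(f, α_p) = rank — sufficiency at ANY good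
-- ordinary prime, reducible included) LANDED p164000 as `Theorems/LeadingTermPinchPrimeOrderEqRankOfSchneiderShaMainConjecture.lean`
-- (with `pinchAt_iff_schneiderSha_of_items`, `PinchPrime_of_schneiderSha_somewhere_of_items` and the item-level content theorem
-- `PinchPrime_iff_schneiderSha_somewhere_of_items` riding along); IMPORTED (v28).

-- v22 stub G13 `stub_schneiderSha_of_pinchAt_kato` (GLUE, NECESSITY at theorem grade: PRS → ∀ W p f, (∀ κ γ,
-- kato_divisibility W p) → 5 ≤ p → IsOrdinaryAt W p → IsNewformOf W f → ord_T L_p(f, α_p) = rank → ∀ Dh canonical,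
-- SchneiderConjecture Dh ∧ Finite Ш[p^∞]) LANDED p139782 as `Theorems/LeadingTermPinchPrimeSchneiderShaOfPinchAtKato.lean`
-- (with `isTorsion_and_order_charGenerator_le_order_padicLFunction_of_kato`,
-- `isTorsion_and_order_charGenerator_eq_rank_of_pinchAt_kato`, `schneiderSha_somewhere_of_PinchPrime_kato`,
-- `samePrimeResidualMinus_of_PinchPrime_kato`, `pinchAt_iff_schneiderSha_of_irreducible_kato` riding along); IMPORTED (v23).

-- v20 stub G12 `stub_pinchAt_of_samePrime` (GLUE: PRS → modularity → BCS → GZK → Bertrand → (J) → (S″) → ∀ W, crux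
-- body — the MINIMAL same-prime residual bridge) LANDED p138339 as
-- `Theorems/LeadingTermPinchPrimePinchAtOfSamePrime.lean` (with `pinchAt_of_analyticRank_le_one_of_rank_zero_or_hasCM`,
-- `two_le_analyticRank_or_of_not_pinchAt`, `samePrime_of_residual` riding along); IMPORTED (v21).
-- v17 stub G11 `stub_openStubs_of_residual` (GLUE: PRS → modularity → BCS → GZK → Bertrand → A′ → S′ →
-- (∀ W, A) ∧ (∀ W, B)) LANDED p138000 as `Theorems/LeadingTermPinchPrimeOpenStubsOfResidual.lean` (with the helpers
-- `exists_goodOrdinary_five_le_not_mem`, `schneiderIO_of_residual`, `cofiniteShaFinite_of_residual`); IMPORTED (v18).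
-- After v18 the registered stubs are exactly the two OPEN residual ones (A′, S′) and the FACTS stub.

-- Landed stubs of v2–v16 (all IMPORTED above as well): `stub_cofiniteIMC` p131521, `stub_leverTrivial` p131733,
-- `stub_leverOrder` p131851, `stub_cofiniteTorsion` p133139, `stub_semisimpleOrder` p133143, G1
-- `stub_orderEqRankOfSchneiderShaAt` p134300, G2 `stub_semisimpleOfSchneiderAt` p134208, G3
-- `stub_semisimpleInfinitelyOftenOfSchneider` p134480, G4
-- `stub_semisimpleInfinitelyOften_iff_schneiderInfinitelyOften` p134659, G5 `stub_pinchAt_of_openStubs`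
-- p134807, G6 `stub_openStubs_of_L_one_ne_zero` p135014, G7 `stub_pinchAt_of_analyticRank_le_one_of_schneiderIO`
-- p135950, G8 `stub_schneider_of_hasCM_of_rank_le_one` p136200, G9 `stub_pinchPrime_of_openRanges` p136607,
-- G10 `stub_pinchAt_of_openRanges_schneider` p136783; Literature fact `bertrand_pairing_self_ne_zero_of_hasCM` p136306.

/-! ## The composition (v26): crux ⟸ G14 (landed) ⟸ facts, A′ (item 17976), S′ (item 17975) -/

/-- ASSEMBLY (v26): the crux `LeadingTerm.PinchPrime` is the LANDED glue G14
`stub_pinchPrime_of_children` (p162919) fed by the three registered stubs — the facts conjunction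
and the two child items A′, S′ (registered stubs with the child items' verbatim statements). -/
theorem PinchPrime_of : LeadingTerm.PinchPrime :=
  stub_pinchPrime_of_children stub_theoremGradeFacts
    stub_cofiniteShaFinite_of_two_le_analyticRank stub_schneiderIO_of_pos_rank

/-! ## The composition (v18–v24, second path): crux ⟸ G5 bridge (landed) ⟸ G11 (landed) ⟸ A′, S′, facts -/

/-- ASSEMBLY (v18 path, kept): the crux `LeadingTerm.PinchPrime` from the registered stubs A′, S′,
facts, through the landed glue G11 `stub_openStubs_of_residual` (p138000) and the landed bridge G5
`stub_pinchAt_of_openStubs` (p134807: modularity → BCS → control → (∀ W, A) → (∀ W, B) → crux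
body), with control the tree theorem `Greenberg1999_coinvariantsRank_eq_selmerCorank_rat_holds`. -/
theorem PinchPrime_of_bridge : LeadingTerm.PinchPrime := by
  obtain ⟨hmod, hBCS, hPRS, hGZK, hBer⟩ := stub_theoremGradeFacts
  obtain ⟨hA, hB⟩ := stub_openStubs_of_residual hPRS hmod hBCS hGZK hBer
    stub_cofiniteShaFinite_of_two_le_analyticRank stub_schneiderIO_of_pos_rank
  intro W _ _
  exact stub_pinchAt_of_openStubs hmod hBCS
    Greenberg1999_coinvariantsRank_eq_selmerCorank_rat_holds hA hB W

/-- The same crux through the landed classical residual bridge G10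
`stub_pinchAt_of_openRanges_schneider` (A′ verbatim; its Schneider hypothesis on
`{r_an ≥ 2} ∪ {r_an = 1, non-CM}` supplied by `schneiderIO_of_residual`), using only the three
registered stubs A′, S′, facts and the landed `schneiderIO_of_residual` — a second, independent
landed path from the same stubs. [cite: MazurSteinTate2006, Conj. 1.1] -/
theorem PinchPrime_of_classical : LeadingTerm.PinchPrime := by
  obtain ⟨hmod, hBCS, hPRS, hGZK, hBer⟩ := stub_theoremGradeFacts
  intro W _ _
  exact stub_pinchAt_of_openRanges_schneider hPRS
    Greenberg1999_coinvariantsRank_eq_selmerCorank_rat_holds hmod hBCS hGZK hBer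
    stub_cofiniteShaFinite_of_two_le_analyticRank
    (fun W _ _ _ B ↦ schneiderIO_of_residual hBer stub_schneiderIO_of_pos_rank W B) W

/-! ## Necessity II (v29–v30, PROVED remark from the landed G16): the crux contains BSD-rank on `{rank ≤ 1}` -/

/-- **Crux ⟹ `r_an = rank` on `{rank ≤ 1}`**, below the six named facts of G16: rank `0` by the
refuter's landed level-zero window (`Negative/ConsequencesOfCrux`, unconditional), rank `1` by G16.
With Gross–Zagier–Kolyvagin (facts-stub conjunct) also on `{r_an ≤ 1}`.
[cite: MazurTateTeitelbaum1986Invent, §I.14 (14.3)] [cite: PerrinRiou1987, Thm. 1.3 and §1.4] -/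
theorem analyticRank_eq_rank_of_rank_le_one_of_PinchPrime
    (hPR : perrinRiou_padicGrossZagier)
    (hGZ : ∀ (N : ℕ) [NeZero N] (W : WeierstrassCurve ℚ) (K : Type) [Field K] [NumberField K],
      gross_zagier N W K)
    (hHeeg : ∀ (W : WeierstrassCurve ℚ) (K : Type) [Field K] [NumberField K],
      exists_isHeegnerPoint W K)
    (hHL : HoffsteinLuo1997_exists_twist_L_one_ne_zero)
    (hlev : ∀ {N : ℕ} [NeZero N], IsNewformOf.level_eq_conductorNorm (N := N))
    (hS : LeadingTerm.PinchPrime) (W : WeierstrassCurve ℚ) [W.IsElliptic] [W.IsGloballyMinimal] :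
    (W.mordellWeilRank ≤ 1 → W.analyticRank = W.mordellWeilRank) ∧
      (W.analyticRank ≤ 1 → W.mordellWeilRank = W.analyticRank) := by
  obtain ⟨hmod, -, -, hGZK, -⟩ := stub_theoremGradeFacts
  refine ⟨fun hle ↦ ?_, fun hle ↦ (hGZK W hle).1⟩
  rcases Nat.le_one_iff_eq_zero_or_eq_one.mp hle with h0 | h1
  · rw [h0]
    exact (Theorems.PinchPrime.Negative.rank_eq_zero_iff_analyticRank_eq_zero_of_pinchPrime hS W).mp h0
  · rw [h1]
    exact stub_analyticRank_eq_one_of_rank_eq_one_of_pinchPrime hPR hGZ hHeeg hmod hHL hlev hS W h1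

/-- **Crux ⟹ the summit's lower bound `r_an ≤ rank` on `{r_an ≤ 2}`** (PROVED remark, v32, from
the landed `SummitFragmentsOfCrux.min_two_analyticRank_le_rank`), below the six named facts of G16.
[cite: PerrinRiou1987, Thm. 1.3 and §1.4] -/
theorem analyticRank_le_rank_of_analyticRank_le_two_of_PinchPrime
    (hPR : perrinRiou_padicGrossZagier)
    (hGZ : ∀ (N : ℕ) [NeZero N] (W : WeierstrassCurve ℚ) (K : Type) [Field K] [NumberField K],
      gross_zagier N W K)
    (hHeeg : ∀ (W : WeierstrassCurve ℚ) (K : Type) [Field K] [NumberField K],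
      exists_isHeegnerPoint W K)
    (hHL : HoffsteinLuo1997_exists_twist_L_one_ne_zero)
    (hlev : ∀ {N : ℕ} [NeZero N], IsNewformOf.level_eq_conductorNorm (N := N))
    (hS : LeadingTerm.PinchPrime) (W : WeierstrassCurve ℚ) [W.IsElliptic] [W.IsGloballyMinimal]
    (h2 : W.analyticRank ≤ 2) : W.analyticRank ≤ W.mordellWeilRank := by
  obtain ⟨hmod, -, -, -, -⟩ := stub_theoremGradeFacts
  have h := Theorems.PinchPrime.Negative.SummitFragments.min_two_analyticRank_le_rank hPR hGZ hHeeg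
    hmod hHL hlev hS W
  rwa [min_eq_right h2] at h

/-- **Crux ⟹ the summit's lower bound `r_an ≤ rank` on `{r_an ≤ 3}`** (PROVED remark, v32; the one
rider of the lead's G17 not in the landed `SummitFragmentsOfCrux`): `r_an = 3` is odd, so LB₂ gives
`rank ≥ 2` and the crux's parity window makes the rank odd, hence `≥ 3`
(`SummitFragments.three_le_rank_of_odd`). Consequence for the route's deciding theorem
`closes hC hP hUB`: the consistency crux `hC` is load-bearing for the lower bound only on `{r_an ≥ 4}`.
[cite: GreenbergLNM1716, §5 (p. 181)] [cite: PerrinRiou1987, Thm. 1.3 and §1.4] -/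
theorem analyticRank_le_rank_of_analyticRank_le_three_of_PinchPrime
    (hPR : perrinRiou_padicGrossZagier)
    (hGZ : ∀ (N : ℕ) [NeZero N] (W : WeierstrassCurve ℚ) (K : Type) [Field K] [NumberField K],
      gross_zagier N W K)
    (hHeeg : ∀ (W : WeierstrassCurve ℚ) (K : Type) [Field K] [NumberField K],
      exists_isHeegnerPoint W K)
    (hHL : HoffsteinLuo1997_exists_twist_L_one_ne_zero)
    (hlev : ∀ {N : ℕ} [NeZero N], IsNewformOf.level_eq_conductorNorm (N := N))
    (hS : LeadingTerm.PinchPrime) (W : WeierstrassCurve ℚ) [W.IsElliptic] [W.IsGloballyMinimal]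
    (h3 : W.analyticRank ≤ 3) : W.analyticRank ≤ W.mordellWeilRank := by
  rcases Nat.lt_or_ge W.analyticRank 3 with hlt | hge
  · exact analyticRank_le_rank_of_analyticRank_le_two_of_PinchPrime hPR hGZ hHeeg hHL hlev hS W
      (by omega)
  · obtain ⟨hmod, -, -, -, -⟩ := stub_theoremGradeFacts
    have h3' : W.analyticRank = 3 := by omega
    rw [h3']
    exact Theorems.PinchPrime.Negative.SummitFragments.three_le_rank_of_odd hPR hGZ hHeeg hmod hHL
      hlev hS W (by rw [h3']; decide) (by omega)

/-! ## Necessity at theorem grade (v22–v23, PROVED remark from the landed G13)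

Modulo the facts stub (only its PRS conjunct is used) and Kato's divisibility for all
`(W, p, κ, γ, f)` (hypothesis — a published theorem, Kato 2004 Thm 17.4, tree named fact
`kato_divisibility`), the crux FORCES the same-prime pair for every curve: this is what ANY proof
of `LeadingTerm.PinchPrime` must establish, whatever its line.
-/

/-- **Crux ⟹ Schneider non-degeneracy AND `#Ш[p^∞] < ∞` at the same good ordinary `p ≥ 5`, for
every `E/ℚ`** (from the registered stubs: PRS out of `stub_theoremGradeFacts`, and G13; Kato's
divisibility a hypothesis). [cite: Kato2004Asterisque, Thm. 17.4 (p. 273)]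
[cite: BalakrishnanMullerStein2015, Thm. 1.7] -/
theorem schneiderSha_somewhere_of_stubs
    (hkato : ∀ (W : WeierstrassCurve ℚ) [W.IsElliptic] [W.IsGloballyMinimal] (p : ℕ) [Fact p.Prime]
      (κ : ZpExtension ℚ p) (γ : Field.absoluteGaloisGroup ℚ) {N : ℕ} [NeZero N]
      (f : CuspForm (Gamma0 N) 2), kato_divisibility W p (κ := κ) (γ := γ) (f := f))
    (hS : LeadingTerm.PinchPrime)
    (W : WeierstrassCurve ℚ) [W.IsElliptic] [W.IsGloballyMinimal] :
    ∃ (p : ℕ) (_ : Fact p.Prime), 5 ≤ p ∧ IsOrdinaryAt W p ∧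
      Finite (AddCommGroup.primaryComponent W.sha p) ∧
      ∀ Dh : WeierstrassCurve.PAdicHeightData W p, Dh.IsCanonical →
        WeierstrassCurve.SchneiderConjecture Dh := by
  obtain ⟨-, -, hPRS, -, -⟩ := stub_theoremGradeFacts
  obtain ⟨p, hp, h5, hord, D, hD, N, hN, f, hf, horder⟩ := hS W
  have key := stub_schneiderSha_of_pinchAt_kato hPRS W p f (fun κ γ ↦ hkato W p κ γ f) h5 hord hf
    horder
  exact ⟨p, hp, h5, hord, (key D hD).2, fun Dh hDh ↦ (key Dh hDh).1⟩

/-- **Crux ⟹ `Ш(E/ℚ)[p^∞]` FINITE at some good ordinary `p ≥ 5` with `corank Sel_{p^∞} = rank`,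
for every `E/ℚ`, modulo Kato's corank bound ALONE** (Astérisque 295 Thm 18.4, named fact
`kato_selmerCorank_le_order_padicLFunction`, hypothesis at every point; no PRS, no main conjecture,
no height): at the pinch prime `corank Sel ≤ ord L_p = rank ≤ corank Sel` (Kummer identity, tree
theorem), so `corank_{ℤ_p} Ш[p^∞] = 0`, and a `p`-primary group with finite `p`-torsion and corank
`0` is finite (`finite_primaryComponent_sha_iff_shaCorank_eq_zero`, tree theorem). The `Ш`-half of
the necessary pair (J⁻) is thus forced by the crux at the grade of Kato 18.4; only the height half
needs Perrin-Riou–Schneider (G13). Sharpens `Negative/ContentOfCrux.shaCotorsion_somewhere_of_leadingTermPinchPrime`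
(corank `0`) to finiteness. [cite: Kato2004, Thm 18.4] -/
theorem shaFinite_somewhere_of_PinchPrime_katoBound
    (hK : ∀ (W : WeierstrassCurve ℚ) [W.IsElliptic] [W.IsGloballyMinimal] (p : ℕ) [Fact p.Prime]
      {N : ℕ} [NeZero N] {f : CuspForm (Gamma0 N) 2},
      kato_selmerCorank_le_order_padicLFunction W p (f := f))
    (hS : LeadingTerm.PinchPrime)
    (W : WeierstrassCurve ℚ) [W.IsElliptic] [W.IsGloballyMinimal] :
    ∃ (p : ℕ) (_ : Fact p.Prime), 5 ≤ p ∧ IsOrdinaryAt W p ∧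
      W.selmerCorank p = W.mordellWeilRank ∧ Finite (AddCommGroup.primaryComponent W.sha p) := by
  obtain ⟨p, hp, h5, hord, -, -, N, hN, f, hf, horder⟩ := hS W
  have hk := hK W p (f := f) (by omega) hord hf
  rw [horder] at hk
  have h1 : W.selmerCorank p ≤ W.mordellWeilRank := by exact_mod_cast hk
  have h2 := W.selmerCorank_eq_mordellWeilRank_add_holds p
  have hsha : W.shaCorank p = 0 := by omega
  exact ⟨p, hp, h5, hord, by omega, (finite_primaryComponent_sha_iff_shaCorank_eq_zero W p).mpr hsha⟩

/-! ## Item-level content theorem (v27–v28, PROVED remark from the landed G15 and the Kato ITEM)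

Modulo the two route ITEMS stmt-15426 (`PAdicOrderV2.PAdicOrderMainConjectureR7`, main conjecture at
every good ordinary `p ≥ 3`) and stmt-18082 (`LeadingTerm.KatoDivisibility`, Kato 2004 Thm. 17.4)
and two published theorems (PRS from the facts stub, modularity from the facts stub), the crux IS
the same-prime statement — the irreducibility gap between (J, S″) and (J⁻, S″⁻) of cycles 5–6 is
closed at item level.
-/

/-- **`LeadingTerm.PinchPrime ⟺ ∀ E/ℚ ∃ good ordinary p ≥ 5, #Ш(E/ℚ)[p^∞] < ∞ ∧ Reg_p(E) ≠ 0`,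
modulo the items stmt-15426, stmt-18082 and the facts stub** (only its modularity and PRS conjuncts
are used): → at the pinch prime by the sibling route's landed
`schneiderSha_of_orderEqRank_katoDivisibility` (Kato item + PRS); ← by G15 with the newform of
modularity and the canonical datum of `exists_isCanonical_holds`.
[cite: BalakrishnanMullerStein2015, Thm. 1.7] [cite: Kato2004Asterisque, Thm. 17.4 (p. 273)]
[cite: MazurSteinTate2006, Conj. 1.1] -/
theorem PinchPrime_iff_schneiderSha_somewhere_items
    (hMC : PAdicOrderV2.PAdicOrderMainConjectureR7) (hK : LeadingTerm.KatoDivisibility) :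
    LeadingTerm.PinchPrime ↔
      ∀ (W : WeierstrassCurve ℚ) [W.IsElliptic] [W.IsGloballyMinimal],
        ∃ (p : ℕ) (_ : Fact p.Prime), 5 ≤ p ∧ IsOrdinaryAt W p ∧
          Finite (AddCommGroup.primaryComponent W.sha p) ∧
          ∀ Dh : WeierstrassCurve.PAdicHeightData W p, Dh.IsCanonical →
            WeierstrassCurve.SchneiderConjecture Dh := by
  obtain ⟨hmod, -, hPRS, -, -⟩ := stub_theoremGradeFacts
  have hK' : PAdicOrderV2.KatoDivisibility :=
    (Iff.rfl : LeadingTerm.KatoDivisibility ↔ PAdicOrderV2.KatoDivisibility).mp hK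
  refine ⟨fun hS W _ _ ↦ ?_, fun h W _ _ ↦ ?_⟩
  · obtain ⟨p, hp, h5, hord, -, -, N, hN, f, hf, horder⟩ := hS W
    exact ⟨p, hp, h5, hord,
      Cruxes.PAdicOrderThesisR2.LambdaAdicGZ.schneiderSha_of_orderEqRank_katoDivisibility hPRS hK'
        W p f h5 hord hf horder⟩
  · haveI : NeZero (W.conductorNorm ℤ) :=
      ⟨(WeierstrassCurve.conductorNorm_pos_holds (W := W)).ne'⟩
    obtain ⟨f, hf⟩ := hmod W
    obtain ⟨p, hp, h5, hord, hsha, hSch⟩ := h W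
    obtain ⟨D, hD⟩ := WeierstrassCurve.exists_isCanonical_holds W p h5 hord.1 hord.2
    exact ⟨p, hp, h5, hord, D, hD, W.conductorNorm ℤ, inferInstance, f, hf,
      stub_orderEqRank_of_schneiderSha_mainConjecture hMC hPRS W p h5 hord hsha hSch f hf⟩

/-! ## The v16 statements as theorems of v17 (PROVED remarks)

* `cofiniteShaFinite_of_stubs` / `semisimpleInfinitelyOften_of_stubs`: the two v16 OPEN stubs (A)
  and (B), verbatim, are theorems modulo the v17 registered stubs.
* `PinchPrime_of_openRanges` / `PinchPrime_of_openRanges_schneider`: the v14/v16 residual bridges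
  with the control hypothesis discharged.
-/

/-- The v16 open stub (A) `stub_cofiniteShaFinite`, verbatim, from the v17 stubs. [cite: Darmon2004, Thm. 3.22] -/
theorem cofiniteShaFinite_of_stubs :
    ∀ (W : WeierstrassCurve ℚ) [W.IsElliptic] [W.IsGloballyMinimal],
      ∃ B : Finset ℕ, ∀ p ∉ B, ∀ [Fact p.Prime], IsOrdinaryAt W p →
        Finite (AddCommGroup.primaryComponent W.sha p) := by
  obtain ⟨-, -, -, hGZK, -⟩ := stub_theoremGradeFacts
  exact fun W _ _ ↦ cofiniteShaFinite_of_residual hGZK stub_cofiniteShaFinite_of_two_le_analyticRank W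

/-- The v16 open stub (B) `stub_semisimpleInfinitelyOften`, verbatim, from the v17 stubs.
[cite: GreenbergLNM1716, §1 Conj. 1.12] -/
theorem semisimpleInfinitelyOften_of_stubs :
    ∀ (W : WeierstrassCurve ℚ) [W.IsElliptic] [W.IsGloballyMinimal], ∀ B : Finset ℕ,
      ∃ p ∉ B, ∃ _ : Fact p.Prime, 5 ≤ p ∧ IsOrdinaryAt W p ∧
        ∃ (κ : ZpExtension ℚ p) (γ : Field.absoluteGaloisGroup ℚ),
          κ.IsCyclotomic ∧ κ.IsTopGenerator γ ∧ IsCyclotomicVariable p γ ∧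
          ∀ D : W.SelmerDualData κ γ,
            LinearMap.ker (IwasawaAlgebra.mulTRat p D.X ∘ₗ IwasawaAlgebra.mulTRat p D.X)
              = LinearMap.ker (IwasawaAlgebra.mulTRat p D.X) := by
  obtain ⟨hmod, hBCS, hPRS, hGZK, hBer⟩ := stub_theoremGradeFacts
  exact (stub_openStubs_of_residual hPRS hmod hBCS hGZK hBer
    stub_cofiniteShaFinite_of_two_le_analyticRank stub_schneiderIO_of_pos_rank).2

/-- **The crux from its residual open content** (v14, from the landed G9; control discharged in
v17): the five theorem-grade facts together with (A) on `{r_an ≥ 2}` and (B) on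
`{r_an ≥ 2} ∪ {r_an = 1, non-CM}` give `LeadingTerm.PinchPrime`.
[cite: Darmon2004, Thm. 3.22] [cite: Bertrand1984ThetaCM, §3 Corollaire 1] -/
theorem PinchPrime_of_openRanges
    (hPRS : Schneider1985_order_charGenerator)
    (hmod : exists_isNewformOf) (hBCS : burungale_castella_skinner_charIdeal_eq_padicLFunction)
    (hGZK : rank_eq_analyticRank_of_analyticRank_le_one)
    (hBer : bertrand_pairing_self_ne_zero_of_hasCM)
    (hA2 : ∀ (W : WeierstrassCurve ℚ) [W.IsElliptic] [W.IsGloballyMinimal], 2 ≤ W.analyticRank →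
      ∃ B : Finset ℕ, ∀ p ∉ B, ∀ [Fact p.Prime], IsOrdinaryAt W p →
        Finite (AddCommGroup.primaryComponent W.sha p))
    (hB2 : ∀ (W : WeierstrassCurve ℚ) [W.IsElliptic] [W.IsGloballyMinimal],
      (2 ≤ W.analyticRank ∨ (W.analyticRank = 1 ∧ ¬ W.HasCM)) → ∀ B : Finset ℕ,
        ∃ p ∉ B, ∃ _ : Fact p.Prime, 5 ≤ p ∧ IsOrdinaryAt W p ∧
          ∃ (κ : ZpExtension ℚ p) (γ : Field.absoluteGaloisGroup ℚ),
            κ.IsCyclotomic ∧ κ.IsTopGenerator γ ∧ IsCyclotomicVariable p γ ∧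
            ∀ D : W.SelmerDualData κ γ,
              LinearMap.ker (IwasawaAlgebra.mulTRat p D.X ∘ₗ IwasawaAlgebra.mulTRat p D.X)
                = LinearMap.ker (IwasawaAlgebra.mulTRat p D.X)) :
    LeadingTerm.PinchPrime :=
  fun W _ _ ↦ stub_pinchPrime_of_openRanges hPRS
    Greenberg1999_coinvariantsRank_eq_selmerCorank_rat_holds hmod hBCS hGZK hBer hA2 hB2 W

/-- **The crux from its residual open content, classical form** (v16, from the landed G10;
control discharged in v17). [cite: MazurSteinTate2006, Conj. 1.1] [cite: Darmon2004, Thm. 3.22] -/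
theorem PinchPrime_of_openRanges_schneider
    (hPRS : Schneider1985_order_charGenerator)
    (hmod : exists_isNewformOf) (hBCS : burungale_castella_skinner_charIdeal_eq_padicLFunction)
    (hGZK : rank_eq_analyticRank_of_analyticRank_le_one)
    (hBer : bertrand_pairing_self_ne_zero_of_hasCM)
    (hA2 : ∀ (W : WeierstrassCurve ℚ) [W.IsElliptic] [W.IsGloballyMinimal], 2 ≤ W.analyticRank →
      ∃ B : Finset ℕ, ∀ p ∉ B, ∀ [Fact p.Prime], IsOrdinaryAt W p →
        Finite (AddCommGroup.primaryComponent W.sha p))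
    (hS2 : ∀ (W : WeierstrassCurve ℚ) [W.IsElliptic] [W.IsGloballyMinimal],
      (2 ≤ W.analyticRank ∨ (W.analyticRank = 1 ∧ ¬ W.HasCM)) → ∀ B : Finset ℕ,
        ∃ p ∉ B, ∃ _ : Fact p.Prime, 5 ≤ p ∧ IsOrdinaryAt W p ∧
          ∀ Dh : WeierstrassCurve.PAdicHeightData W p, Dh.IsCanonical →
            WeierstrassCurve.SchneiderConjecture Dh) :
    LeadingTerm.PinchPrime :=
  fun W _ _ ↦ stub_pinchAt_of_openRanges_schneider hPRS
    Greenberg1999_coinvariantsRank_eq_selmerCorank_rat_holds hmod hBCS hGZK hBer hA2 hS2 W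

/-! ## Monotonicity of the reshapes and tightness of the open pair (PROVED remarks, v3–v5;
## control discharged in v17)

* `semisimple_of_stable`: the v3 stub's condition at `p` (stability one layer up) implies the
  v4 condition at `p` (semisimplicity), via the LANDED lever `stub_leverTrivial` (`T·X = 0`) and
  `mulTRat_eq_zero_of_X_smul_eq_zero` (`T = 0` on `V`).
* `order_eq_selmerCorank_of_stable`: at a stable prime, WITHOUT `Ш`-finiteness,
  `ord_T f_E = corank Sel_{p^∞}(E/ℚ) = rank + corank Ш[p^∞]` — the `Ш`-stub is needed exactly to
  kill `corank Ш[p^∞]` AT THE SAME PRIME (barrier note B1).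
* `schneiderConjecture_of_stable`: at a stable prime with `Ш[p^∞]` finite the canonical height
  is non-degenerate, modulo Perrin-Riou–Schneider (hypothesis).
* `semisimple_and_shaCorank_eq_zero_of_order_eq_rank`: conversely, `ord_T f_E = rank` at a good
  ordinary `p` (what the crux asserts at its pinch prime, through the main conjecture) FORCES
  semisimplicity at `0` and `corank Ш[p^∞] = 0`: prime by prime the crux at `p` is EXACTLY the
  open pair, so the line's only freedom is the quantifier split.
-/

/-- **Stability one layer up ⟹ semisimplicity at `0`.** [folklore] -/
theorem semisimple_of_stable
    (W : WeierstrassCurve ℚ) [W.IsElliptic] [W.IsGloballyMinimal] (p : ℕ) [Fact p.Prime]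
    (κ : ZpExtension ℚ p) (γ : Field.absoluteGaloisGroup ℚ)
    (hκ : κ.IsCyclotomic) (hγ : κ.IsTopGenerator γ)
    (hstab : ∀ s : W.selmerInfty κ,
      ((W.conjSelmerInfty κ γ) ^ p) s = s → W.conjSelmerInfty κ γ s = s)
    (D : W.SelmerDualData κ γ) [Module.Finite (IwasawaAlgebra p) D.X] :
    IwasawaAlgebra.mulTRat p D.X = 0 ∧ D.IsTorsion ∧
      LinearMap.ker (IwasawaAlgebra.mulTRat p D.X ∘ₗ IwasawaAlgebra.mulTRat p D.X)
        = LinearMap.ker (IwasawaAlgebra.mulTRat p D.X) := by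
  have hT := stub_leverTrivial W p κ γ hκ hγ hstab D
  have hT0 : ∀ x : D.X, (PowerSeries.X : IwasawaAlgebra p) • x = 0 := fun x ↦ by
    have h := Submodule.smul_mem_smul
      (Ideal.mem_span_singleton_self (PowerSeries.X : IwasawaAlgebra p))
      (Submodule.mem_top : x ∈ (⊤ : Submodule (IwasawaAlgebra p) D.X))
    rw [hT] at h
    exact (Submodule.mem_bot _).mp h
  have hX : D.IsTorsion := fun x ↦
    ⟨⟨PowerSeries.X, mem_nonZeroDivisors_of_ne_zero PowerSeries.X_ne_zero⟩, hT0 x⟩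
  have h0 : IwasawaAlgebra.mulTRat p D.X = 0 := mulTRat_eq_zero_of_X_smul_eq_zero D.X hT0
  exact ⟨h0, hX, by rw [h0, LinearMap.zero_comp]⟩

/-- **At a stable prime, `ord_T f_E = corank_{ℤ_p} Sel_{p^∞}(E/ℚ) = rank + corank Ш[p^∞]`**
(no `Ш`-finiteness assumed; control is the tree theorem): stability ⟹ `T·X = 0`
(`stub_leverTrivial`) ⟹ `X` torsion, `T = 0` on `ℚ_p ⊗ X` ⟹ `ord_T f_E = rank_{ℤ_p} X/TX`
(`Greenberg1999_order_charGenerator_eq_coinvariantsRank_holds`) `= corank Sel_{p^∞}(E/ℚ)`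
(control) `= rank + corank Ш[p^∞]` (`selmerCorank_eq_mordellWeilRank_add_holds`).
[cite: GreenbergLNM1716, Thm 1.2] -/
theorem order_eq_selmerCorank_of_stable
    (W : WeierstrassCurve ℚ) [W.IsElliptic] [W.IsGloballyMinimal] (p : ℕ) [Fact p.Prime]
    (hord : IsOrdinaryAt W p) (κ : ZpExtension ℚ p) (γ : Field.absoluteGaloisGroup ℚ)
    (hκ : κ.IsCyclotomic) (hγ : κ.IsTopGenerator γ)
    (hstab : ∀ s : W.selmerInfty κ,
      ((W.conjSelmerInfty κ γ) ^ p) s = s → W.conjSelmerInfty κ γ s = s)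
    (D : W.SelmerDualData κ γ) [Module.Finite (IwasawaAlgebra p) D.X]
    (fE : IwasawaAlgebra p) (hfE : D.charIdeal = Ideal.span {fE}) :
    fE.order = W.selmerCorank p ∧ fE.order = W.mordellWeilRank + W.shaCorank p := by
  obtain ⟨h0, hX, hss⟩ := semisimple_of_stable W p κ γ hκ hγ hstab D
  have h1 : fE.order = (IwasawaAlgebra.coinvariantsRank p D.X : ℕ∞) :=
    Greenberg1999_order_charGenerator_eq_coinvariantsRank_holds p D.X hX fE hfE hss
  obtain ⟨-, h2⟩ :=
    Greenberg1999_coinvariantsRank_eq_selmerCorank_rat_holds W p hord.1 hord.2 κ γ hκ hγ D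
  have h3 : W.selmerCorank p = W.mordellWeilRank + W.shaCorank p :=
    W.selmerCorank_eq_mordellWeilRank_add_holds p
  refine ⟨by rw [h1, h2], ?_⟩
  rw [h1, h2, h3, Nat.cast_add]

/-- **At a stable prime with `Ш[p^∞]` finite, the canonical `p`-adic height is non-degenerate**
(Schneider's conjecture at `p`), modulo Perrin-Riou–Schneider (hypothesis): the lever gives
`ord_T f_E = rank` (`stub_leverOrder`, control the tree theorem) and clause 2 of PRS converts it.
[cite: BalakrishnanMullerStein2015, Thm. 1.7] -/
theorem schneiderConjecture_of_stable (hPRS : Schneider1985_order_charGenerator)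
    (W : WeierstrassCurve ℚ) [W.IsElliptic] [W.IsGloballyMinimal] (p : ℕ) [Fact p.Prime]
    (h5 : 5 ≤ p) (hord : IsOrdinaryAt W p) (κ : ZpExtension ℚ p) (γ : Field.absoluteGaloisGroup ℚ)
    (hκ : κ.IsCyclotomic) (hγ : κ.IsTopGenerator γ) (hγ' : IsCyclotomicVariable p γ)
    (hstab : ∀ s : W.selmerInfty κ,
      ((W.conjSelmerInfty κ γ) ^ p) s = s → W.conjSelmerInfty κ γ s = s)
    (hsha : Finite (AddCommGroup.primaryComponent W.sha p))
    (Dh : WeierstrassCurve.PAdicHeightData W p) (hDh : Dh.IsCanonical) :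
    WeierstrassCurve.SchneiderConjecture Dh := by
  obtain ⟨D⟩ := W.nonempty_selmerDualData_holds κ γ hγ
  haveI : Module.Finite (IwasawaAlgebra p) D.X := D.module_finite_of_isCyclotomic W κ hκ hγ
  obtain ⟨fE, hfE⟩ : ∃ fE : IwasawaAlgebra p, D.charIdeal = Ideal.span {fE} := by
    have hP : (D.charIdeal).IsPrincipal := charIdeal_isPrincipal_holds p D.X
    exact ⟨hP.generator, (Ideal.span_singleton_generator D.charIdeal).symm⟩
  have hT := stub_leverTrivial W p κ γ hκ hγ hstab D
  obtain ⟨-, hX, -⟩ := semisimple_of_stable W p κ γ hκ hγ hstab D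
  have horder : fE.order = W.mordellWeilRank :=
    stub_leverOrder Greenberg1999_coinvariantsRank_eq_selmerCorank_rat_holds W p h5 hord κ γ hκ hγ
      D hT hsha fE hfE
  exact ((hPRS W p h5 hord.1 hord.2 κ γ hκ hγ hγ' D hX fE hfE Dh hDh).2.1.mp horder).1

/-- **Necessity of the open pair at the pinch prime** (control is the tree theorem): for `E/ℚ`
elliptic (globally minimal `W`), `p` good ordinary, the cyclotomic datum `(κ, γ)`, a finitely
generated torsion Iwasawa datum `D` with `char X = (f_E)`: if `ord_T f_E = rank_ℤ E(ℚ)` then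
`ker T² = ker T` on `ℚ_p ⊗ X`, `corank_{ℤ_p} Ш(E/ℚ)[p^∞] = 0` and `corank Sel_{p^∞}(E/ℚ) = rank`.
[cite: GreenbergLNM1716, §1 p. 9 (after Conj. 1.12)] -/
theorem semisimple_and_shaCorank_eq_zero_of_order_eq_rank
    (W : WeierstrassCurve ℚ) [W.IsElliptic] [W.IsGloballyMinimal] (p : ℕ) [Fact p.Prime]
    (hord : IsOrdinaryAt W p) (κ : ZpExtension ℚ p) (γ : Field.absoluteGaloisGroup ℚ)
    (hκ : κ.IsCyclotomic) (hγ : κ.IsTopGenerator γ)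
    (D : W.SelmerDualData κ γ) [Module.Finite (IwasawaAlgebra p) D.X] (hX : D.IsTorsion)
    (fE : IwasawaAlgebra p) (hfE : D.charIdeal = Ideal.span {fE})
    (horder : fE.order = W.mordellWeilRank) :
    LinearMap.ker (IwasawaAlgebra.mulTRat p D.X ∘ₗ IwasawaAlgebra.mulTRat p D.X)
        = LinearMap.ker (IwasawaAlgebra.mulTRat p D.X) ∧
      W.shaCorank p = 0 ∧ W.selmerCorank p = W.mordellWeilRank := by
  have hle1 : (W.selmerCorank p : ℕ∞) ≤ fE.order :=
    selmerCorank_le_order_charGenerator Greenberg1999_coinvariantsRank_eq_selmerCorank_rat_holds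
      W p hord.1 hord.2 hκ hγ D hX hfE
  rw [horder, Nat.cast_le] at hle1
  have h3 : W.selmerCorank p = W.mordellWeilRank + W.shaCorank p :=
    W.selmerCorank_eq_mordellWeilRank_add_holds p
  have hsha : W.shaCorank p = 0 := by omega
  have hsel : W.selmerCorank p = W.mordellWeilRank := by omega
  obtain ⟨-, h2⟩ :=
    Greenberg1999_coinvariantsRank_eq_selmerCorank_rat_holds W p hord.1 hord.2 κ γ hκ hγ D
  have hco : fE.order = (IwasawaAlgebra.coinvariantsRank p D.X : ℕ∞) := by
    rw [h2, hsel, horder]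
  exact ⟨(IwasawaAlgebra.order_charGenerator_eq_coinvariantsRank_iff p hX fE hfE).mp hco, hsha, hsel⟩

/-! ## Height-side presentation and the standard conjectures (PROVED remarks, v6–v9; control
## discharged in v17) -/

/-- **Schneider's conjecture ⟹ the v16 height-side stub (B), curve by curve** (modulo PRS,
modularity, BCS — hypotheses): if `Reg_p(E, Dh) ≠ 0` for every good ordinary `p ≥ 5` and
canonical `Dh`, and `Ш(E/ℚ)[p^∞]` is finite for all good ordinary `p` outside a finite set, then
outside any finite set there is a good ordinary `p ≥ 5` with the cyclotomic datum at which `T` is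
semisimple at `0` on `ℚ_p ⊗ X(E/ℚ_∞)` for every Iwasawa datum (the landed G3).
[cite: MazurSteinTate2006, Conj. 1.1] [cite: GreenbergLNM1716, §1 Conj. 1.12] -/
theorem semisimpleInfinitelyOften_of_schneiderConjecture
    (hPRS : Schneider1985_order_charGenerator)
    (hmod : exists_isNewformOf) (hBCS : burungale_castella_skinner_charIdeal_eq_padicLFunction)
    (W : WeierstrassCurve ℚ) [W.IsElliptic] [W.IsGloballyMinimal]
    (hSch : ∀ (p : ℕ) [Fact p.Prime], 5 ≤ p → IsOrdinaryAt W p →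
      ∀ Dh : WeierstrassCurve.PAdicHeightData W p, Dh.IsCanonical →
        WeierstrassCurve.SchneiderConjecture Dh)
    (hSha : ∃ B : Finset ℕ, ∀ p ∉ B, ∀ [Fact p.Prime], IsOrdinaryAt W p →
      Finite (AddCommGroup.primaryComponent W.sha p))
    (B : Finset ℕ) :
    ∃ p ∉ B, ∃ _ : Fact p.Prime, 5 ≤ p ∧ IsOrdinaryAt W p ∧
      ∃ (κ : ZpExtension ℚ p) (γ : Field.absoluteGaloisGroup ℚ),
        κ.IsCyclotomic ∧ κ.IsTopGenerator γ ∧ IsCyclotomicVariable p γ ∧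
        ∀ D : W.SelmerDualData κ γ,
          LinearMap.ker (IwasawaAlgebra.mulTRat p D.X ∘ₗ IwasawaAlgebra.mulTRat p D.X)
            = LinearMap.ker (IwasawaAlgebra.mulTRat p D.X) :=
  stub_semisimpleInfinitelyOftenOfSchneider hPRS
    Greenberg1999_coinvariantsRank_eq_selmerCorank_rat_holds hmod hBCS W
    (fun p _ h5 hord Dh hDh ↦ hSch p h5 hord Dh hDh) hSha B

/-- **Under the standard conjectures the v17 residual stubs A′, S′ hold** (trivially: they are
range restrictions of `ShaFiniteConjecture` and of Schneider's conjecture at every good ordinary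
`p ≥ 5`), hence so do the v16 stubs and the crux (modulo the facts). [cite: MazurSteinTate2006, Conj. 1.1]
[cite: Tate1974, Conj. 1] -/
theorem residualStubs_of_standardConjectures
    (hSha : ShaFiniteConjecture)
    (hSch : ∀ (W : WeierstrassCurve ℚ) [W.IsElliptic] [W.IsGloballyMinimal] (p : ℕ) [Fact p.Prime],
      5 ≤ p → IsOrdinaryAt W p →
      ∀ Dh : WeierstrassCurve.PAdicHeightData W p, Dh.IsCanonical →
        WeierstrassCurve.SchneiderConjecture Dh) :
    (∀ (W : WeierstrassCurve ℚ) [W.IsElliptic] [W.IsGloballyMinimal], 2 ≤ W.analyticRank →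
      ∃ B : Finset ℕ, ∀ p ∉ B, ∀ [Fact p.Prime], IsOrdinaryAt W p →
        Finite (AddCommGroup.primaryComponent W.sha p)) ∧
    (∀ (W : WeierstrassCurve ℚ) [W.IsElliptic] [W.IsGloballyMinimal], 1 ≤ W.mordellWeilRank →
      (W.HasCM → 2 ≤ W.mordellWeilRank) → ∀ B : Finset ℕ,
        ∃ p ∉ B, ∃ _ : Fact p.Prime, 5 ≤ p ∧ IsOrdinaryAt W p ∧
          ∀ Dh : WeierstrassCurve.PAdicHeightData W p, Dh.IsCanonical →
            WeierstrassCurve.SchneiderConjecture Dh) := by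
  refine ⟨fun W _ _ _ ↦ ?_, fun W _ _ _ _ B ↦ ?_⟩
  · haveI : Finite W.sha := hSha W ‹_›
    exact ⟨∅, fun p _ _ _ ↦ inferInstance⟩
  · obtain ⟨p, hpB, hp, h5, hord⟩ := exists_goodOrdinary_five_le_not_mem W B
    exact ⟨p, hpB, hp, h5, hord, fun Dh hDh ↦ hSch W p h5 hord Dh hDh⟩

/-- Sanity link to the landed height-side bridge (G1 corollary): under the standard conjectures and
the three facts PRS, modularity, BCS, the `W`-instance of the crux holds for every `W`.
[cite: MazurSteinTate2006, Conj. 1.1] -/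
theorem pinchAt_of_standardConjectures (hPRS : Schneider1985_order_charGenerator)
    (hmod : exists_isNewformOf) (hBCS : burungale_castella_skinner_charIdeal_eq_padicLFunction)
    (hSha : ShaFiniteConjecture)
    (hSch : ∀ (W : WeierstrassCurve ℚ) [W.IsElliptic] [W.IsGloballyMinimal] (p : ℕ) [Fact p.Prime],
      5 ≤ p → IsOrdinaryAt W p →
      ∀ Dh : WeierstrassCurve.PAdicHeightData W p, Dh.IsCanonical →
        WeierstrassCurve.SchneiderConjecture Dh)
    (W : WeierstrassCurve ℚ) [W.IsElliptic] [W.IsGloballyMinimal] :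
    ∃ (p : ℕ) (_ : Fact p.Prime), 5 ≤ p ∧ IsOrdinaryAt W p ∧
      ∃ (D : WeierstrassCurve.PAdicHeightData W p), D.IsCanonical ∧
        ∃ (N : ℕ) (_ : NeZero N) (f : CuspForm (Gamma0 N) 2), IsNewformOf W f ∧
          (padicLFunction f (unitRoot W p : ℚ_[p])).order = W.mordellWeilRank :=
  PinchPrime_of_standardConjectures hPRS hmod hBCS hSha hSch W

/-- **(A) ⟹ [(B) ⟺ Schneider at infinitely many good ordinary primes]** for the two v16 stubs,
curve by curve, modulo PRS, modularity, BCS (hypotheses; control discharged): the landed G4.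
[cite: MazurSteinTate2006, Conj. 1.1] [cite: GreenbergLNM1716, §1 Conj. 1.12 and p. 9] -/
theorem openStubB_iff_schneiderInfinitelyOften
    (hPRS : Schneider1985_order_charGenerator)
    (hmod : exists_isNewformOf) (hBCS : burungale_castella_skinner_charIdeal_eq_padicLFunction)
    (W : WeierstrassCurve ℚ) [W.IsElliptic] [W.IsGloballyMinimal]
    (hA : ∃ B : Finset ℕ, ∀ p ∉ B, ∀ [Fact p.Prime], IsOrdinaryAt W p →
        Finite (AddCommGroup.primaryComponent W.sha p)) :
    (∀ B : Finset ℕ, ∃ p ∉ B, ∃ _ : Fact p.Prime, 5 ≤ p ∧ IsOrdinaryAt W p ∧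
        ∃ (κ : ZpExtension ℚ p) (γ : Field.absoluteGaloisGroup ℚ),
          κ.IsCyclotomic ∧ κ.IsTopGenerator γ ∧ IsCyclotomicVariable p γ ∧
          ∀ D : W.SelmerDualData κ γ,
            LinearMap.ker (IwasawaAlgebra.mulTRat p D.X ∘ₗ IwasawaAlgebra.mulTRat p D.X)
              = LinearMap.ker (IwasawaAlgebra.mulTRat p D.X)) ↔
    (∀ B : Finset ℕ, ∃ p ∉ B, ∃ _ : Fact p.Prime, 5 ≤ p ∧ IsOrdinaryAt W p ∧
        ∀ Dh : WeierstrassCurve.PAdicHeightData W p, Dh.IsCanonical →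
          WeierstrassCurve.SchneiderConjecture Dh) :=
  stub_semisimpleInfinitelyOften_iff_schneiderInfinitelyOften hPRS
    Greenberg1999_coinvariantsRank_eq_selmerCorank_rat_holds hmod hBCS W hA

/-! ## The known slices (PROVED remarks, v10–v13; control discharged in v17)

* analytic rank `0` (`L(E,1) ≠ 0`): G6 `stub_openStubs_of_L_one_ne_zero` (landed, imported);
* CM curves of analytic rank `≤ 1`: `pinchAt_of_hasCM_of_analyticRank_le_one` (G7 + G8);
* what is NOT known, and is now literally the registered open content: A′ (analytic rank `≥ 2`)
  and S′ (rank `≥ 1`, not CM-of-rank-`1`).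
-/

/-- **CM, analytic rank `≤ 1` ⟹ Schneider non-degeneracy outside every finite set of primes**
(indeed at every good ordinary `p ≥ 5`; modulo GZK and Bertrand — hypotheses).
[cite: Bertrand1984ThetaCM, §3 Corollaire 1] [cite: Darmon2004, Thm. 3.22] -/
theorem schneiderIO_of_hasCM_of_analyticRank_le_one
    (hBer : bertrand_pairing_self_ne_zero_of_hasCM)
    (hGZK : rank_eq_analyticRank_of_analyticRank_le_one)
    (W : WeierstrassCurve ℚ) [W.IsElliptic] [W.IsGloballyMinimal] (hCM : W.HasCM)
    (han : W.analyticRank ≤ 1) (B : Finset ℕ) :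
    ∃ p ∉ B, ∃ _ : Fact p.Prime, 5 ≤ p ∧ IsOrdinaryAt W p ∧
      ∀ Dh : WeierstrassCurve.PAdicHeightData W p, Dh.IsCanonical →
        WeierstrassCurve.SchneiderConjecture Dh := by
  have hrk : W.mordellWeilRank ≤ 1 := by
    rw [(hGZK W han).1]
    exact han
  obtain ⟨p, hpB, hp, h5, hord⟩ := exists_goodOrdinary_five_le_not_mem W B
  exact ⟨p, hpB, hp, h5, hord, fun Dh hDh ↦
    stub_schneider_of_hasCM_of_rank_le_one hBer W hCM hrk p h5 hord Dh hDh⟩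

/-- **Every CM curve of analytic rank `≤ 1` satisfies its instance of the crux** (the `∃ p`-body of
`LeadingTerm.PinchPrime` at `W`), modulo PRS, BCS, modularity, Gross–Zagier–Kolyvagin and
Bertrand — hypotheses, all theorem-grade named facts: G7 fed by
`schneiderIO_of_hasCM_of_analyticRank_le_one`. [cite: Bertrand1984ThetaCM, §3 Corollaire 1]
[cite: Darmon2004, Thm. 3.22] [cite: BalakrishnanMullerStein2015, Thm. 1.7] -/
theorem pinchAt_of_hasCM_of_analyticRank_le_one
    (hPRS : Schneider1985_order_charGenerator)
    (hBCS : burungale_castella_skinner_charIdeal_eq_padicLFunction)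
    (hmod : exists_isNewformOf) (hGZK : rank_eq_analyticRank_of_analyticRank_le_one)
    (hBer : bertrand_pairing_self_ne_zero_of_hasCM)
    (W : WeierstrassCurve ℚ) [W.IsElliptic] [W.IsGloballyMinimal] (hCM : W.HasCM)
    (han : W.analyticRank ≤ 1) :
    ∃ (p : ℕ) (_ : Fact p.Prime), 5 ≤ p ∧ IsOrdinaryAt W p ∧
      ∃ (D : WeierstrassCurve.PAdicHeightData W p), D.IsCanonical ∧
        ∃ (N : ℕ) (_ : NeZero N) (f : CuspForm (Gamma0 N) 2), IsNewformOf W f ∧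
          (padicLFunction f (unitRoot W p : ℚ_[p])).order = W.mordellWeilRank :=
  stub_pinchAt_of_analyticRank_le_one_of_schneiderIO hPRS hBCS hmod hGZK W han
    (schneiderIO_of_hasCM_of_analyticRank_le_one hBer hGZK W hCM han)

/-- **For a CM curve of analytic rank `≤ 1` both v16 stubs hold** (A with `B = ∅` by GZK; B by the
landed G3 fed by G8), modulo PRS, modularity, BCS, GZK and Bertrand — hypotheses (control
discharged). [cite: Bertrand1984ThetaCM, §3 Corollaire 1] [cite: Darmon2004, Thm. 3.22]
[cite: GreenbergLNM1716, §1 Conj. 1.12] -/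
theorem openStubs_of_hasCM_of_analyticRank_le_one
    (hPRS : Schneider1985_order_charGenerator)
    (hmod : exists_isNewformOf) (hBCS : burungale_castella_skinner_charIdeal_eq_padicLFunction)
    (hGZK : rank_eq_analyticRank_of_analyticRank_le_one)
    (hBer : bertrand_pairing_self_ne_zero_of_hasCM)
    (W : WeierstrassCurve ℚ) [W.IsElliptic] [W.IsGloballyMinimal] (hCM : W.HasCM)
    (han : W.analyticRank ≤ 1) :
    (∃ B : Finset ℕ, ∀ p ∉ B, ∀ [Fact p.Prime], IsOrdinaryAt W p →
      Finite (AddCommGroup.primaryComponent W.sha p)) ∧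
    (∀ B : Finset ℕ, ∃ p ∉ B, ∃ _ : Fact p.Prime, 5 ≤ p ∧ IsOrdinaryAt W p ∧
      ∃ (κ : ZpExtension ℚ p) (γ : Field.absoluteGaloisGroup ℚ),
        κ.IsCyclotomic ∧ κ.IsTopGenerator γ ∧ IsCyclotomicVariable p γ ∧
        ∀ D : W.SelmerDualData κ γ,
          LinearMap.ker (IwasawaAlgebra.mulTRat p D.X ∘ₗ IwasawaAlgebra.mulTRat p D.X)
            = LinearMap.ker (IwasawaAlgebra.mulTRat p D.X)) := by
  have hrk : W.mordellWeilRank ≤ 1 := by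
    rw [(hGZK W han).1]
    exact han
  have hA : ∃ B : Finset ℕ, ∀ p ∉ B, ∀ [Fact p.Prime], IsOrdinaryAt W p →
      Finite (AddCommGroup.primaryComponent W.sha p) :=
    cofiniteShaFinite_of_analyticRank_le_one hGZK W han
  exact ⟨hA, fun B ↦ stub_semisimpleInfinitelyOftenOfSchneider hPRS
    Greenberg1999_coinvariantsRank_eq_selmerCorank_rat_holds hmod hBCS W
    (fun p _ h5 hord Dh hDh ↦ stub_schneider_of_hasCM_of_rank_le_one hBer W hCM hrk p h5 hord Dh hDh)
    hA B⟩

/-! ## The minimal (same-prime) residual (v19, PROVED remarks)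

By the necessity theorem (`semisimple_and_shaCorank_eq_zero_of_order_eq_rank`; refuter's
`Negative/ContentOfCrux.leadingTermPinchPrime_iff_schneiderSha_somewhere`) the crux at `W` needs
`Ш[p^∞]` finite AND `Reg_p ≠ 0` at ONE admissible prime. So the WEAKEST sufficient residual, given
the known slices, is the pair
* (J)  every curve of analytic rank `≥ 2` has ONE good ordinary `p ≥ 5` with `E[p]` irreducible,
       `Ш(E/ℚ)[p^∞]` finite and `Reg_p(E, Dh) ≠ 0` for the canonical datum;
* (S″) every non-CM curve of analytic rank `1` has ONE good ordinary `p ≥ 5` with `E[p]`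
       irreducible and `Reg_p(E, Dh) ≠ 0` (`= h_p(P) ≠ 0` up to index, `P` a generator),
and `PinchPrime_of_samePrime` proves the crux from (J), (S″) and the five facts through the landed
G12 `stub_pinchAt_of_samePrime` (p138339; pointwise bridge G1 at the supplied prime, known slices
elsewhere); the landed `samePrime_of_residual` (same file) shows that the registered stubs A′, S′
imply (J), (S″) (irreducibility is cofinite, `exists_forall_hasIrreducibleModPGaloisRep_of_lt`), and
`two_le_analyticRank_or_of_not_pinchAt` (same file) records the shape of a counterexample. The registered split A′ × S′ (cofinite ×
infinitely often) is kept because it separates the `Ш`-programme from the height programme; (J) is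
their same-prime meet on analytic rank `≥ 2`.
-/

/-- **The crux from the same-prime residual (J), (S″)** and the five facts (hypotheses), through
the landed pointwise bridge G1 and the known slices. [cite: BalakrishnanMullerStein2015, Thm. 1.7]
[cite: MazurSteinTate2006, Conj. 1.1] [cite: Darmon2004, Thm. 3.22] -/
theorem PinchPrime_of_samePrime
    (hPRS : Schneider1985_order_charGenerator)
    (hmod : exists_isNewformOf) (hBCS : burungale_castella_skinner_charIdeal_eq_padicLFunction)
    (hGZK : rank_eq_analyticRank_of_analyticRank_le_one)
    (hBer : bertrand_pairing_self_ne_zero_of_hasCM)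
    (hJ : ∀ (W : WeierstrassCurve ℚ) [W.IsElliptic] [W.IsGloballyMinimal], 2 ≤ W.analyticRank →
      ∃ (p : ℕ) (_ : Fact p.Prime), 5 ≤ p ∧ IsOrdinaryAt W p ∧ W.HasIrreducibleModPGaloisRep p ∧
        Finite (AddCommGroup.primaryComponent W.sha p) ∧
        ∀ Dh : WeierstrassCurve.PAdicHeightData W p, Dh.IsCanonical →
          WeierstrassCurve.SchneiderConjecture Dh)
    (hS : ∀ (W : WeierstrassCurve ℚ) [W.IsElliptic] [W.IsGloballyMinimal], W.analyticRank = 1 →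
      ¬ W.HasCM →
      ∃ (p : ℕ) (_ : Fact p.Prime), 5 ≤ p ∧ IsOrdinaryAt W p ∧ W.HasIrreducibleModPGaloisRep p ∧
        ∀ Dh : WeierstrassCurve.PAdicHeightData W p, Dh.IsCanonical →
          WeierstrassCurve.SchneiderConjecture Dh) :
    LeadingTerm.PinchPrime :=
  fun W _ _ ↦ stub_pinchAt_of_samePrime hPRS hmod hBCS hGZK hBer hJ hS W

end Summit.BirchSwinnertonDyer.BirchSwinnertonDyer.Cruxes.PinchPrime.FirstLayerStability

end
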